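import Summits.Ventures.CertifiedManyBodySolver.Observables.MeanFieldClassExclusionObjectE
import Literature.MathematicalPhysics.QuantumLattice.HubbardFermiSeaTangentRowsLow
import Literature.MathematicalPhysics.QuantumLattice.HubbardFermiSeaTangentRowsLowB
import HarnessLib

/-!
# Ventures/CertifiedManyBodySolver — Observables/MeanFieldClassExclusionObjectEHg1223.lean

HONEST FRAMING: first certified bounds; not a superconductivity verdict; every number certified or labelled float.
A competing-order EXCLUSION removes a named class of candidate ground states; it never says which order is present;
no phase sentence follows.

Cell `hubbard-tc` (MO-S3, D-0096), seat `hubbard-tc-mod-3` (G3), `prover-hubbard-tc-mod-3-g4-0`. HgBa₂Ca₂Cu₃O₈₊δ (Hg-1223, VSET M35,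
TRILAYER read per CuO₂ plane on OBJECT E; S1 box of record `pub/hubbard-downfold/router/BOXES/HgBa2Ca2Cu3O8.md`, outer-plane OP and
inner-plane IP sublattices) at the three PRESSURE columns of the cell's table (P = 0, 15, 30 GPa). Object-E faces (union of OP and IP):
P = 0: `t′/t_eff ∈ [−0.50, −0.365]`, `n ∈ [0.800, 0.861]`, `U/t_eff ∈ [1.6, 8.9]`; P = 15: `[−0.443, −0.288] × [0.761, 0.861] × [1.1, 10.1]`;
P = 30: `[−0.440, −0.276] × [0.722, 0.861] × [1.4, 8.8]`. The MF/BCS class (every non-magnetic Hartree–Fock / singlet-BCS state; Wick: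
`docc ≥ (n/2)²`) is excluded as ground state — `Re ω(n_{0↑} n_{0↓}) < (n/2)²` for every GS torus limit — on the UPPER-`U` part of each box:

* `hg1223E_P0_docc_lt_of`:  `t′ ∈ [−1/2, −73/200]`, `n ∈ [4/5, 861/1000]`,     EVERY `U ≥ 13/2` (covers `[6.5, 8.9]` of the P = 0 boxes; margin `+0.029`);
* `hg1223E_P15_docc_lt_of`: `t′ ∈ [−1/2, −36/125]`, `n ∈ [761/1000, 861/1000]`, EVERY `U ≥ 7`   (covers `[7, 10.1]`; `+0.043`);
* `hg1223E_P30_docc_lt_of`: `t′ ∈ [−1/2, −69/250]`, `n ∈ [722/1000, 861/1000]`, EVERY `U ≥ 15/2` (covers `[7.5, 8.8]`; `+0.023`);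

all conditional on the claim nodes of CERTIFIED #445 and #473 by hypothesis. Below the thresholds (down to `U/t_eff ≈ 1–1.6`) NO class word is
possible with the rows of record (the free-gas gap `U(n/2)²` itself vanishes): «undetermined-MF». Devices = `MeanFieldClassExclusionObjectE.lean`
§1 verbatim: the `t′`-chord cap at `n = 7/8` (`objE_conc78_cap8`, #445 ∧ #473, `t′ ≤ −1/4`) carried down by the vacuum chord
(`objE_lowBand_cap8`, bilinear term linearised at the band top), tangent Fermi-sea floors read between the columns `−1/2, −2/5, −3/10, −1/4`
by concavity (`objE_floor_between`; touch `3/4` / `39/50` for `n ≤ 4/5`, `21/25` / `17/20` above), the class constant above its tangent at the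
lower band edge, and the `U`-tail `doccN_lt_of_cap8_threshold`. Exact designer: `hubbard-tc-mod-3/g4-replay/deep_design.py` (Hg-1223 block).
WHAT THIS IS NOT: a statement about stripes, d-wave order, interlayer physics or T_c; the saturated-FM class; tight; a phase word.

References: T. Koma, H. Tasaki, J. Stat. Phys. 76 (1994) 745, §1 [KomaTasaki1994]; V. Bach, E. H. Lieb, J. P. Solovej,
J. Stat. Phys. 76 (1994) 3, eq. (2c.36) [BachLiebSolovej1994]; E. H. Lieb, M. Loss, Duke Math. J. 71 (1993) 337, §8 Thm 8.2
[LiebLoss1993]; R. B. Israel, Convexity in the Theory of Lattice Gases (1979), Thm I.3.4 [Israel1979]; D. Ruelle,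
Statistical Mechanics (1969) §3.3 [Ruelle1969].
-/

noncomputable section

namespace Summit.Ventures.CertifiedManyBodySolver.Observables

open Literature.MathematicalPhysics.QuantumLattice
open Literature.MathematicalPhysics.QuantumLattice.ThermodynamicLimit
open Summit.Ventures.CertifiedManyBodySolver.Certificates
open Matrix HubbardWave0 Literature.Probability.LatticeModels Filter Topology
open scoped ComplexOrder BigOperators

/-- **Hg-1223 (M35) at P = 0, OBJECT E (OP ∪ IP planes: `t′/t_eff ∈ [−0.50, −0.365]`, `n ∈ [0.800, 0.861]`, `U/t_eff ∈ [1.6, 8.9]`) — MF/BCS class excluded on the sub-box `U ≥ 13/2`:** for `t′ ∈ [−1/2, −73/200]`, EVERY `U ≥ 13/2`, `n ∈ [4/5, 861/1000]`; cond. #445 ∧ #473; `t′`-chord cap + vacuum chord; floors touching at `21/25` on the columns `−1/2, −2/5, −3/10`; smallest margin `+0.029`. [cite: KomaTasaki1994, §1] [cite: BachLiebSolovej1994, eq. (2c.36)] [cite: LiebLoss1993, §8, Theorem 8.2] -/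
theorem hg1223E_P0_docc_lt_of (h445 : cert_dbt329pair_allk)
    (h473 : cert_r473_bs_M3U8tp0_w3_b4_R2_ob5p2_kry1_kry2c3rel_hanK7B4D4_KN4_PR20d4_hanK8c2s_hanK8B4D4_uprime)
    {t' U n : ℝ} (ht1 : -1 / 2 ≤ t') (ht2 : t' ≤ -73 / 200) (hU : 13 / 2 ≤ U)
    (hn1 : 4 / 5 ≤ n) (hn2 : n ≤ 861 / 1000) :
    ∀ (ω : InfVolFermionState 2) (Ls : ℕ → ℕ) (ψ : ∀ L, Fock (Orb (FermionTorus 2 L))),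
      Tendsto Ls atTop atTop →
      (∀ j, IsGroundStateInSector (hubbardTorusTT' (Ls j) 1 t' U) (rectN n (Ls j)) 0 (ψ (Ls j))) →
      (∀ j, star (ψ (Ls j)) ⬝ᵥ ψ (Ls j) = 1) → ω.IsTorusLimitOf ψ Ls →
      (ω.expect ({0} : Finset (Site 2))
        (nAt 0 (Finset.mem_singleton_self 0) 0 * nAt 0 (Finset.mem_singleton_self 0) 1)).re < (n / 2) ^ 2 := by
  have hn0 : (0 : ℝ) ≤ n := by linarith
  have hn2' : n < 2 := by linarith
  have hnpos : (0 : ℝ) < n := by linarith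
  -- the class constant `(n/2)²` above its tangent at `n = 4/5`, scaled by the threshold `U₁ = 13/2`
  have hsq : (-4 / 25 : ℝ) + 2 / 5 * n ≤ (n / 2) ^ 2 := by nlinarith [sq_nonneg (n - 4 / 5)]
  have hsqU : ((-4 / 25 : ℝ) + 2 / 5 * n) * (13 / 2) ≤ (n / 2) ^ 2 * (13 / 2) :=
    mul_le_mul_of_nonneg_right hsq (by norm_num)
  have hR := objE_conc78_cap8 h445 h473 (s := t') (by linarith)
  have hBs : (0 : ℝ) ≤ -0.6023622600 * t' := mul_nonneg_of_nonpos_of_nonpos (by norm_num) (by linarith)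
  have uh := fermiSeaTangentRow_tPrime_neg_one_div_two_at_twentyone_div_twentyfive (U := 0) le_rfl hn0 hn2'
  have uf := fermiSeaTangentRow_tPrime_neg_two_div_five_at_twentyone_div_twentyfive (U := 0) le_rfl hn0 hn2'
  have ut := fermiSeaTangentRow_tPrime_neg_three_div_ten_at_twentyone_div_twentyfive (U := 0) le_rfl hn0 hn2'
  rcases le_or_gt t' (-2 / 5) with hp0 | hp0
  · -- piece `t' ∈ [-1/2, -2/5]`
    have hfl := objE_floor_between hn0 hn2' (by norm_num : (-1 / 2 : ℝ) ≤ -2 / 5) uh uf ht1 hp0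
    have hcap := objE_lowBand_cap8 hR hBs hnpos hn2 (by norm_num)
    exact doccN_lt_of_cap8_threshold (U₁ := 13 / 2) (by norm_num) (by norm_num) hU hn0 hn2' hcap hfl
      (sub_min_lt_of (by linarith) (by linarith))
  · -- piece `t' ∈ [-2/5, -3/10]` (last)
    have hfl := objE_floor_between hn0 hn2' (by norm_num : (-2 / 5 : ℝ) ≤ -3 / 10) uf ut hp0.le (by linarith)
    have hcap := objE_lowBand_cap8 hR hBs hnpos hn2 (by norm_num)
    exact doccN_lt_of_cap8_threshold (U₁ := 13 / 2) (by norm_num) (by norm_num) hU hn0 hn2' hcap hfl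
      (sub_min_lt_of (by linarith) (by linarith))

/-- **Hg-1223 (M35) at P = 15 GPa, OBJECT E (`t′/t_eff ∈ [−0.443, −0.288]`, `n ∈ [0.761, 0.861]`, `U/t_eff ∈ [1.1, 10.1]`) — MF/BCS class excluded on `U ≥ 7`:** for `t′ ∈ [−1/2, −36/125]`, EVERY `U ≥ 7`, `n ∈ [761/1000, 861/1000]`; cond. #445 ∧ #473; bands split at `4/5` (floors touching at `3/4` / `39/50` below, `21/25` / `17/20` above); smallest margin `+0.043`. [cite: KomaTasaki1994, §1] [cite: BachLiebSolovej1994, eq. (2c.36)] [cite: LiebLoss1993, §8, Theorem 8.2] -/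
theorem hg1223E_P15_docc_lt_of (h445 : cert_dbt329pair_allk)
    (h473 : cert_r473_bs_M3U8tp0_w3_b4_R2_ob5p2_kry1_kry2c3rel_hanK7B4D4_KN4_PR20d4_hanK8c2s_hanK8B4D4_uprime)
    {t' U n : ℝ} (ht1 : -1 / 2 ≤ t') (ht2 : t' ≤ -36 / 125) (hU : 7 ≤ U)
    (hn1 : 761 / 1000 ≤ n) (hn2 : n ≤ 861 / 1000) :
    ∀ (ω : InfVolFermionState 2) (Ls : ℕ → ℕ) (ψ : ∀ L, Fock (Orb (FermionTorus 2 L))),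
      Tendsto Ls atTop atTop →
      (∀ j, IsGroundStateInSector (hubbardTorusTT' (Ls j) 1 t' U) (rectN n (Ls j)) 0 (ψ (Ls j))) →
      (∀ j, star (ψ (Ls j)) ⬝ᵥ ψ (Ls j) = 1) → ω.IsTorusLimitOf ψ Ls →
      (ω.expect ({0} : Finset (Site 2))
        (nAt 0 (Finset.mem_singleton_self 0) 0 * nAt 0 (Finset.mem_singleton_self 0) 1)).re < (n / 2) ^ 2 := by
  have hn0 : (0 : ℝ) ≤ n := by linarith
  have hn2' : n < 2 := by linarith
  have hnpos : (0 : ℝ) < n := by linarith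
  -- the class constant `(n/2)²` above its tangent at `n = 761/1000`, scaled by the threshold `U₁ = 7`
  have hsq : (-579121 / 4000000 : ℝ) + 761 / 2000 * n ≤ (n / 2) ^ 2 := by nlinarith [sq_nonneg (n - 761 / 1000)]
  have hsqU : ((-579121 / 4000000 : ℝ) + 761 / 2000 * n) * (7) ≤ (n / 2) ^ 2 * (7) :=
    mul_le_mul_of_nonneg_right hsq (by norm_num)
  have hR := objE_conc78_cap8 h445 h473 (s := t') (by linarith)
  have hBs : (0 : ℝ) ≤ -0.6023622600 * t' := mul_nonneg_of_nonpos_of_nonpos (by norm_num) (by linarith)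
  have lh := fermiSeaTangentRow_tPrime_neg_one_div_two_at_three_div_four (U := 0) le_rfl hn0 hn2'
  have lf := fermiSeaTangentRow_tPrime_neg_two_div_five_at_three_div_four (U := 0) le_rfl hn0 hn2'
  have lt := fermiSeaTangentRow_tPrime_neg_three_div_ten_at_three_div_four (U := 0) le_rfl hn0 hn2'
  have lq := fermiSeaTangentRow_tPrime_neg_one_div_four_at_thirtynine_div_fifty (U := 0) le_rfl hn0 hn2'
  have uh := fermiSeaTangentRow_tPrime_neg_one_div_two_at_twentyone_div_twentyfive (U := 0) le_rfl hn0 hn2'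
  have uf := fermiSeaTangentRow_tPrime_neg_two_div_five_at_twentyone_div_twentyfive (U := 0) le_rfl hn0 hn2'
  have ut := fermiSeaTangentRow_tPrime_neg_three_div_ten_at_twentyone_div_twentyfive (U := 0) le_rfl hn0 hn2'
  have uq := fermiSeaTangentRow_tPrime_neg_one_div_four_at_seventeen_div_twenty (U := 0) le_rfl hn0 hn2'
  rcases le_or_gt t' (-2 / 5) with hp0 | hp0
  · -- piece `t' ∈ [-1/2, -2/5]`
    rcases le_or_gt n (4 / 5) with hb | _hb
    · -- band `n ≤ 4/5`: floors touching at `3/4` (`39/50` on the `-1/4` column)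
      have hfl := objE_floor_between hn0 hn2' (by norm_num : (-1 / 2 : ℝ) ≤ -2 / 5) lh lf ht1 hp0
      have hcap := objE_lowBand_cap8 hR hBs hnpos hb (by norm_num)
      exact doccN_lt_of_cap8_threshold (U₁ := 7) (by norm_num) (by norm_num) hU hn0 hn2' hcap hfl
        (sub_min_lt_of (by linarith) (by linarith))
    · -- band `n > 4/5`: floors touching at `21/25` (`17/20`)
      have hfl := objE_floor_between hn0 hn2' (by norm_num : (-1 / 2 : ℝ) ≤ -2 / 5) uh uf ht1 hp0
      have hcap := objE_lowBand_cap8 hR hBs hnpos hn2 (by norm_num)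
      exact doccN_lt_of_cap8_threshold (U₁ := 7) (by norm_num) (by norm_num) hU hn0 hn2' hcap hfl
        (sub_min_lt_of (by linarith) (by linarith))
  rcases le_or_gt t' (-3 / 10) with hp1 | hp1
  · -- piece `t' ∈ [-2/5, -3/10]`
    rcases le_or_gt n (4 / 5) with hb | _hb
    · -- band `n ≤ 4/5`: floors touching at `3/4` (`39/50` on the `-1/4` column)
      have hfl := objE_floor_between hn0 hn2' (by norm_num : (-2 / 5 : ℝ) ≤ -3 / 10) lf lt hp0.le hp1
      have hcap := objE_lowBand_cap8 hR hBs hnpos hb (by norm_num)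
      exact doccN_lt_of_cap8_threshold (U₁ := 7) (by norm_num) (by norm_num) hU hn0 hn2' hcap hfl
        (sub_min_lt_of (by linarith) (by linarith))
    · -- band `n > 4/5`: floors touching at `21/25` (`17/20`)
      have hfl := objE_floor_between hn0 hn2' (by norm_num : (-2 / 5 : ℝ) ≤ -3 / 10) uf ut hp0.le hp1
      have hcap := objE_lowBand_cap8 hR hBs hnpos hn2 (by norm_num)
      exact doccN_lt_of_cap8_threshold (U₁ := 7) (by norm_num) (by norm_num) hU hn0 hn2' hcap hfl
        (sub_min_lt_of (by linarith) (by linarith))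
  · -- piece `t' ∈ [-3/10, -1/4]` (last)
    rcases le_or_gt n (4 / 5) with hb | _hb
    · -- band `n ≤ 4/5`: floors touching at `3/4` (`39/50` on the `-1/4` column)
      have hfl := objE_floor_between hn0 hn2' (by norm_num : (-3 / 10 : ℝ) ≤ -1 / 4) lt lq hp1.le (by linarith)
      have hcap := objE_lowBand_cap8 hR hBs hnpos hb (by norm_num)
      exact doccN_lt_of_cap8_threshold (U₁ := 7) (by norm_num) (by norm_num) hU hn0 hn2' hcap hfl
        (sub_min_lt_of (by linarith) (by linarith))
    · -- band `n > 4/5`: floors touching at `21/25` (`17/20`)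
      have hfl := objE_floor_between hn0 hn2' (by norm_num : (-3 / 10 : ℝ) ≤ -1 / 4) ut uq hp1.le (by linarith)
      have hcap := objE_lowBand_cap8 hR hBs hnpos hn2 (by norm_num)
      exact doccN_lt_of_cap8_threshold (U₁ := 7) (by norm_num) (by norm_num) hU hn0 hn2' hcap hfl
        (sub_min_lt_of (by linarith) (by linarith))

/-- **Hg-1223 (M35) at P = 30 GPa, OBJECT E (`t′/t_eff ∈ [−0.440, −0.276]`, `n ∈ [0.722, 0.861]`, `U/t_eff ∈ [1.4, 8.8]`) — MF/BCS class excluded on `U ≥ 15/2`:** for `t′ ∈ [−1/2, −69/250]`, EVERY `U ≥ 15/2`, `n ∈ [722/1000, 861/1000]`; cond. #445 ∧ #473; bands split at `4/5`; smallest margin `+0.023`. [cite: KomaTasaki1994, §1] [cite: BachLiebSolovej1994, eq. (2c.36)] [cite: LiebLoss1993, §8, Theorem 8.2] -/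
theorem hg1223E_P30_docc_lt_of (h445 : cert_dbt329pair_allk)
    (h473 : cert_r473_bs_M3U8tp0_w3_b4_R2_ob5p2_kry1_kry2c3rel_hanK7B4D4_KN4_PR20d4_hanK8c2s_hanK8B4D4_uprime)
    {t' U n : ℝ} (ht1 : -1 / 2 ≤ t') (ht2 : t' ≤ -69 / 250) (hU : 15 / 2 ≤ U)
    (hn1 : 361 / 500 ≤ n) (hn2 : n ≤ 861 / 1000) :
    ∀ (ω : InfVolFermionState 2) (Ls : ℕ → ℕ) (ψ : ∀ L, Fock (Orb (FermionTorus 2 L))),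
      Tendsto Ls atTop atTop →
      (∀ j, IsGroundStateInSector (hubbardTorusTT' (Ls j) 1 t' U) (rectN n (Ls j)) 0 (ψ (Ls j))) →
      (∀ j, star (ψ (Ls j)) ⬝ᵥ ψ (Ls j) = 1) → ω.IsTorusLimitOf ψ Ls →
      (ω.expect ({0} : Finset (Site 2))
        (nAt 0 (Finset.mem_singleton_self 0) 0 * nAt 0 (Finset.mem_singleton_self 0) 1)).re < (n / 2) ^ 2 := by
  have hn0 : (0 : ℝ) ≤ n := by linarith
  have hn2' : n < 2 := by linarith
  have hnpos : (0 : ℝ) < n := by linarith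
  -- the class constant `(n/2)²` above its tangent at `n = 361/500`, scaled by the threshold `U₁ = 15/2`
  have hsq : (-130321 / 1000000 : ℝ) + 361 / 1000 * n ≤ (n / 2) ^ 2 := by nlinarith [sq_nonneg (n - 361 / 500)]
  have hsqU : ((-130321 / 1000000 : ℝ) + 361 / 1000 * n) * (15 / 2) ≤ (n / 2) ^ 2 * (15 / 2) :=
    mul_le_mul_of_nonneg_right hsq (by norm_num)
  have hR := objE_conc78_cap8 h445 h473 (s := t') (by linarith)
  have hBs : (0 : ℝ) ≤ -0.6023622600 * t' := mul_nonneg_of_nonpos_of_nonpos (by norm_num) (by linarith)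
  have lh := fermiSeaTangentRow_tPrime_neg_one_div_two_at_three_div_four (U := 0) le_rfl hn0 hn2'
  have lf := fermiSeaTangentRow_tPrime_neg_two_div_five_at_three_div_four (U := 0) le_rfl hn0 hn2'
  have lt := fermiSeaTangentRow_tPrime_neg_three_div_ten_at_three_div_four (U := 0) le_rfl hn0 hn2'
  have lq := fermiSeaTangentRow_tPrime_neg_one_div_four_at_thirtynine_div_fifty (U := 0) le_rfl hn0 hn2'
  have uh := fermiSeaTangentRow_tPrime_neg_one_div_two_at_twentyone_div_twentyfive (U := 0) le_rfl hn0 hn2'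
  have uf := fermiSeaTangentRow_tPrime_neg_two_div_five_at_twentyone_div_twentyfive (U := 0) le_rfl hn0 hn2'
  have ut := fermiSeaTangentRow_tPrime_neg_three_div_ten_at_twentyone_div_twentyfive (U := 0) le_rfl hn0 hn2'
  have uq := fermiSeaTangentRow_tPrime_neg_one_div_four_at_seventeen_div_twenty (U := 0) le_rfl hn0 hn2'
  rcases le_or_gt t' (-2 / 5) with hp0 | hp0
  · -- piece `t' ∈ [-1/2, -2/5]`
    rcases le_or_gt n (4 / 5) with hb | _hb
    · -- band `n ≤ 4/5`: floors touching at `3/4` (`39/50` on the `-1/4` column)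
      have hfl := objE_floor_between hn0 hn2' (by norm_num : (-1 / 2 : ℝ) ≤ -2 / 5) lh lf ht1 hp0
      have hcap := objE_lowBand_cap8 hR hBs hnpos hb (by norm_num)
      exact doccN_lt_of_cap8_threshold (U₁ := 15 / 2) (by norm_num) (by norm_num) hU hn0 hn2' hcap hfl
        (sub_min_lt_of (by linarith) (by linarith))
    · -- band `n > 4/5`: floors touching at `21/25` (`17/20`)
      have hfl := objE_floor_between hn0 hn2' (by norm_num : (-1 / 2 : ℝ) ≤ -2 / 5) uh uf ht1 hp0
      have hcap := objE_lowBand_cap8 hR hBs hnpos hn2 (by norm_num)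
      exact doccN_lt_of_cap8_threshold (U₁ := 15 / 2) (by norm_num) (by norm_num) hU hn0 hn2' hcap hfl
        (sub_min_lt_of (by linarith) (by linarith))
  rcases le_or_gt t' (-3 / 10) with hp1 | hp1
  · -- piece `t' ∈ [-2/5, -3/10]`
    rcases le_or_gt n (4 / 5) with hb | _hb
    · -- band `n ≤ 4/5`: floors touching at `3/4` (`39/50` on the `-1/4` column)
      have hfl := objE_floor_between hn0 hn2' (by norm_num : (-2 / 5 : ℝ) ≤ -3 / 10) lf lt hp0.le hp1
      have hcap := objE_lowBand_cap8 hR hBs hnpos hb (by norm_num)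
      exact doccN_lt_of_cap8_threshold (U₁ := 15 / 2) (by norm_num) (by norm_num) hU hn0 hn2' hcap hfl
        (sub_min_lt_of (by linarith) (by linarith))
    · -- band `n > 4/5`: floors touching at `21/25` (`17/20`)
      have hfl := objE_floor_between hn0 hn2' (by norm_num : (-2 / 5 : ℝ) ≤ -3 / 10) uf ut hp0.le hp1
      have hcap := objE_lowBand_cap8 hR hBs hnpos hn2 (by norm_num)
      exact doccN_lt_of_cap8_threshold (U₁ := 15 / 2) (by norm_num) (by norm_num) hU hn0 hn2' hcap hfl
        (sub_min_lt_of (by linarith) (by linarith))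
  · -- piece `t' ∈ [-3/10, -1/4]` (last)
    rcases le_or_gt n (4 / 5) with hb | _hb
    · -- band `n ≤ 4/5`: floors touching at `3/4` (`39/50` on the `-1/4` column)
      have hfl := objE_floor_between hn0 hn2' (by norm_num : (-3 / 10 : ℝ) ≤ -1 / 4) lt lq hp1.le (by linarith)
      have hcap := objE_lowBand_cap8 hR hBs hnpos hb (by norm_num)
      exact doccN_lt_of_cap8_threshold (U₁ := 15 / 2) (by norm_num) (by norm_num) hU hn0 hn2' hcap hfl
        (sub_min_lt_of (by linarith) (by linarith))
    · -- band `n > 4/5`: floors touching at `21/25` (`17/20`)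
      have hfl := objE_floor_between hn0 hn2' (by norm_num : (-3 / 10 : ℝ) ≤ -1 / 4) ut uq hp1.le (by linarith)
      have hcap := objE_lowBand_cap8 hR hBs hnpos hn2 (by norm_num)
      exact doccN_lt_of_cap8_threshold (U₁ := 15 / 2) (by norm_num) (by norm_num) hU hn0 hn2' hcap hfl
        (sub_min_lt_of (by linarith) (by linarith))

end Summit.Ventures.CertifiedManyBodySolver.Observables

end
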